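import Summits.CriticalPhenomena.PercolationContinuityZ3.Theses.PercAntiMeanFieldOnset
import Literature.Probability.Percolation.PercolationProofs
import Mathlib.Probability.Independence.InfinitePi
import HarnessLib

/-!
# Coupling toolkit for `PercAntiMeanFieldOnset.OnsetIncrementBound` (stmt-CriticalPhenomena-5108):
# independence of one label from the others under `labelMeasure`

RSW3 lane (cell `prim-rsw3`, prover P2, gen 31).  Helper lemmas (`--supports stmt-CriticalPhenomena-5108`)
for the monotone-coupling proof of Russo's inequality at the left endpoint: under the i.i.d. uniform label
law `labelMeasure V = ⨂_e U[0,1]` the label `U_e` is independent of the σ-algebra generated by the other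
labels, so `ν(B ∩ {U_e ∈ I}) = ν(B) · Leb(I ∩ [0,1])` for every event `B` measurable with respect to the
labels off `e`; and the level-`p` configuration with the edge `e` removed,
`U ↦ configOfLabels p U G \ {e}`, is measurable with respect to the labels off `e`.  Nothing here uses
p205010.
-/

noncomputable section

namespace Summit.CriticalPhenomena.PercolationContinuityZ3.Theorems.Coupling

open MeasureTheory ProbabilityTheory Literature.Probability.Percolation

variable {V : Type*}

/-- The σ-algebra generated by the labels off `e`. -/
theorem offSigma_le (e : Sym2 V) :
    (⨆ f ∈ ({e}ᶜ : Set (Sym2 V)), MeasurableSpace.comap (fun U : Sym2 V → ℝ => U f) inferInstance) ≤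
      (inferInstance : MeasurableSpace (Sym2 V → ℝ)) :=
  iSup₂_le fun f _ => (measurable_pi_apply f).comap_le

/-- **One label is independent of the others**: the σ-algebra of `U_e` and the σ-algebra of
`(U_f)_{f ≠ e}` are independent under `labelMeasure`. -/
theorem indep_eval_offSigma (e : Sym2 V) :
    Indep (MeasurableSpace.comap (fun U : Sym2 V → ℝ => U e) inferInstance)
      (⨆ f ∈ ({e}ᶜ : Set (Sym2 V)), MeasurableSpace.comap (fun U : Sym2 V → ℝ => U f) inferInstance)
      (labelMeasure V) := by
  haveI hprob : IsProbabilityMeasure ((volume : Measure ℝ).restrict (Set.Icc (0 : ℝ) 1)) := by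
    refine ⟨?_⟩
    rw [Measure.restrict_apply_univ, Real.volume_Icc]; simp
  have hind : iIndepFun (fun (f : Sym2 V) (U : Sym2 V → ℝ) => U f) (labelMeasure V) := by
    unfold labelMeasure
    exact iIndepFun_infinitePi (P := fun _ : Sym2 V => (volume : Measure ℝ).restrict (Set.Icc (0 : ℝ) 1))
      (X := fun _ x => x) fun _ => measurable_id
  have hI := hind.iIndep
  have h := indep_iSup_of_disjoint (m := fun f => MeasurableSpace.comap (fun U : Sym2 V → ℝ => U f) inferInstance)
    (fun f => (measurable_pi_apply f).comap_le) hI (Set.disjoint_singleton_left.2 (fun h : e ∈ ({e}ᶜ : Set (Sym2 V)) => h rfl))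
  simpa [iSup_singleton] using h

/-- **Product formula**: `ν(B ∩ {U_e ∈ I}) = ν(B) · Leb(I ∩ [0,1])` for `B` measurable w.r.t. the labels off
`e` and a Borel set `I`. -/
theorem labelMeasure_inter_eval_preimage (e : Sym2 V) {B : Set (Sym2 V → ℝ)}
    (hB : MeasurableSet[⨆ f ∈ ({e}ᶜ : Set (Sym2 V)), MeasurableSpace.comap (fun U : Sym2 V → ℝ => U f) inferInstance] B)
    {I : Set ℝ} (hI : MeasurableSet I) :
    labelMeasure V (B ∩ (fun U : Sym2 V → ℝ => U e) ⁻¹' I) =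
      labelMeasure V B * volume (I ∩ Set.Icc (0 : ℝ) 1) := by
  have h := (Indep_iff _ _ _).1 (indep_eval_offSigma (V := V) e) ((fun U : Sym2 V → ℝ => U e) ⁻¹' I) B
    ⟨I, hI, rfl⟩ hB
  rw [Set.inter_comm, h, mul_comm]
  congr 1
  haveI hprob : IsProbabilityMeasure ((volume : Measure ℝ).restrict (Set.Icc (0 : ℝ) 1)) := by
    refine ⟨?_⟩
    rw [Measure.restrict_apply_univ, Real.volume_Icc]; simp
  have hmap := Measure.infinitePi_map_eval (fun _ : Sym2 V => (volume : Measure ℝ).restrict (Set.Icc (0 : ℝ) 1)) e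
  have : labelMeasure V ((fun U : Sym2 V → ℝ => U e) ⁻¹' I) =
      ((labelMeasure V).map (fun U : Sym2 V → ℝ => U e)) I := by
    rw [Measure.map_apply (measurable_pi_apply e) hI]
  rw [this]
  unfold labelMeasure
  rw [hmap, Measure.restrict_apply hI]

/-- **The configuration off `e` is measurable w.r.t. the labels off `e`**: for every `p` and graph `G`,
`U ↦ configOfLabels p U G \ {e}` is measurable from the σ-algebra of `(U_f)_{f ≠ e}`. -/
theorem measurable_configOfLabels_sdiff (p : ℝ) (G : SimpleGraph V) (e : Sym2 V) :
    Measurable[⨆ f ∈ ({e}ᶜ : Set (Sym2 V)), MeasurableSpace.comap (fun U : Sym2 V → ℝ => U f) inferInstance]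
      (fun U : Sym2 V → ℝ => configOfLabels p U G \ {e}) := by
  classical
  letI mΩ : MeasurableSpace (Sym2 V → ℝ) :=
    ⨆ f ∈ ({e}ᶜ : Set (Sym2 V)), MeasurableSpace.comap (fun U : Sym2 V → ℝ => U f) inferInstance
  refine measurable_set_iff.2 fun f => ?_
  by_cases hf : f = e
  · subst hf
    have : (fun U : Sym2 V → ℝ => f ∈ configOfLabels p U G \ {f}) = fun _ => False := by
      funext U; simp
    rw [this]; exact measurable_const
  · have hmeas : MeasurableSet[mΩ] {U : Sym2 V → ℝ | U f ≤ p} := by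
      have hle : MeasurableSpace.comap (fun U : Sym2 V → ℝ => U f) inferInstance ≤ mΩ :=
        le_iSup₂ (f := fun f _ => MeasurableSpace.comap (fun U : Sym2 V → ℝ => U f) inferInstance) f hf
      exact hle _ ⟨Set.Iic p, measurableSet_Iic, rfl⟩
    have hfun : (fun U : Sym2 V → ℝ => f ∈ configOfLabels p U G \ {e}) = fun U => f ∈ G.edgeSet ∧ U ∈ {U : Sym2 V → ℝ | U f ≤ p} := by
      funext U
      simp [configOfLabels, hf]
    rw [hfun]
    refine measurable_to_prop ?_
    by_cases he : f ∈ G.edgeSet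
    · have : (fun U : Sym2 V → ℝ => f ∈ G.edgeSet ∧ U ∈ {U : Sym2 V → ℝ | U f ≤ p}) ⁻¹' {True} = {U | U f ≤ p} := by
        ext U; simp [he]
      rw [this]; exact hmeas
    · have : (fun U : Sym2 V → ℝ => f ∈ G.edgeSet ∧ U ∈ {U : Sym2 V → ℝ | U f ≤ p}) ⁻¹' {True} = ∅ := by
        ext U; simp [he]
      rw [this]; exact MeasurableSet.empty

end Summit.CriticalPhenomena.PercolationContinuityZ3.Theorems.Coupling
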